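import Literature.Computability.MetaComplexity.ResolutionTseitinProofs
import Summits.PneNP.PneNP.Theorems.ReslinMediumCoverManyMediumLinesBoundaryLawCount
import Summits.PneNP.PneNP.Theorems.ReslinMediumCoverManyMediumLinesCritDensityFibres

/-!
# PneNP / ReslinMediumCover — CRITICAL DENSITY: `|critAt G c u| = 2^{3N² - N + 1}`
(stub CD of the birth skeleton of crux `ManyMediumLines`, stmt-PneNP-19698)

Route `PneNP/ReslinMediumCover`, crux `Summit.PneNP.PneNP.Theses.ReslinMediumCover.ManyMediumLines`
(open problem; NOT claimed). For a CONNECTED graph `G` on `Fin N` and a charge `c` with an odd number of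
charged vertices, the number of `u`-critical assignments of the `3N²` slots of `τ(G, c) ∘ MAJ₃` is exactly
`2^{3N² - N + 1}` for every vertex `u` (`card_critAt`). Proof: an assignment is `u`-critical iff its vector
of lifted edge values `y` solves the linear system `∂y = c + 1_u` over `𝔽₂` (incidence / coboundary map);
the system has rank `N - 1` (the kernel of the coboundary map of a connected graph is the line of
constants), so it has `2^{|E| - N + 1}` solutions (`card_Sol_eq_two_pow`); and every vector of lifted
edge values has exactly `2^{3N² - |E|}` preimages (`card_filter_edgeVal_eq`). With the boundary law
(`card_falsifiers_le_of_edgeCut_nonempty`) this is the second of the three stubs of the counting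
skeleton; the cover stub MC remains open.

References: S. Jukna, *Boolean Function Complexity* (2012), §18.7 (critical assignments; cosets of the
cycle space); A. Urquhart, J. ACM 34 (1987), §4, Lemma 4.1; N. Biggs, *Algebraic Graph Theory* (1974),
Ch. 4, Prop. 4.3 (the incidence matrix of a connected graph has rank `N - 1`).
-/

namespace Summit.PneNP.PneNP.Theorems

-- `Summit.PneNP.PneNP` repeats a path component by design (summit = sub-problem); silence the linter.
set_option linter.dupNamespace false

namespace ResLinBoundaryLaw

open Finset Module Literature.Computability.Complexity Literature.Computability.MetaComplexity
open Literature.Computability.MetaComplexity.AffSys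

variable {N : ℕ} (G : SimpleGraph (Fin N)) [DecidableRel G.Adj] (c : Fin N → Bool)

/-! ### Sums over the edges at a vertex -/

/-- The edges of `G` containing `w` are the edges `{w, w'}`, `w'` a neighbour of `w`. -/
theorem filter_mem_edgeFinset_eq_image (w : Fin N) :
    (G.edgeFinset.filter fun e => w ∈ e) = (G.neighborFinset w).image fun w' => s(w, w') := by
  ext e
  rw [Finset.mem_filter, Finset.mem_image, SimpleGraph.mem_edgeFinset]
  constructor
  · rintro ⟨he, hw⟩
    induction e using Sym2.ind with
    | h a b =>
      rw [Sym2.mem_iff] at hw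
      rcases hw with rfl | rfl
      · exact ⟨b, (SimpleGraph.mem_neighborFinset G w b).mpr (by rwa [SimpleGraph.mem_edgeSet] at he), rfl⟩
      · refine ⟨a, (SimpleGraph.mem_neighborFinset G w a).mpr ?_, Sym2.eq_swap⟩
        rw [SimpleGraph.mem_edgeSet] at he
        exact he.symm
  · rintro ⟨w', hw', rfl⟩
    rw [SimpleGraph.mem_neighborFinset] at hw'
    exact ⟨(SimpleGraph.mem_edgeSet G).mpr hw', Sym2.mem_mk_left _ _⟩

/-- Summing a function of the edges at `w`: the dot product of the incidence row of `w` with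
`e ↦ f e` is the sum of `f {w, w'}` over the neighbours `w'` of `w`. -/
theorem indicatorRow_dotProduct {M : Type*} [CommSemiring M] (f : Sym2 (Fin N) → M) (w : Fin N) :
    (fun e : ↥G.edgeFinset => if w ∈ e.1 then (1 : M) else 0) ⬝ᵥ (fun e => f e.1) =
      ∑ w' ∈ G.neighborFinset w, f s(w, w') := by
  unfold dotProduct
  have h1 : ∀ e : ↥G.edgeFinset, (if w ∈ e.1 then (1 : M) else 0) * f e.1 =
      if w ∈ e.1 then f e.1 else 0 := by
    intro e
    by_cases hw : w ∈ e.1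
    · rw [if_pos hw, if_pos hw, one_mul]
    · rw [if_neg hw, if_neg hw, zero_mul]
  rw [Finset.sum_congr rfl (fun e _ => h1 e),
    Finset.sum_coe_sort G.edgeFinset (fun e => if w ∈ e then f e else 0), ← Finset.sum_filter,
    filter_mem_edgeFinset_eq_image, Finset.sum_image]
  intro a _ b _ h
  exact Sym2.congr_right.mp h

/-! ### The coboundary map of a connected graph has the constants as kernel -/

omit [DecidableRel G.Adj] in
/-- A function constant along the edges of a connected graph is constant. -/
theorem eq_of_forall_adj_eq {K : Type*} {l : Fin N → K} (h : ∀ a b, G.Adj a b → l a = l b)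
    {v w : Fin N} (p : G.Walk v w) : l v = l w := by
  induction p with
  | nil => rfl
  | cons hadj _ ih => exact (h _ _ hadj).trans ih

/-! ### The critical density -/

/-- **Critical density** (stub CD of crux `ManyMediumLines`): for a connected graph `G` on `Fin N`, a
charge `c` with an odd number of charged vertices, and every vertex `u`, exactly `2^{3N² - N + 1}`
assignments of the `3N²` slots are `u`-critical for `τ(G, c) ∘ MAJ₃`. [Jukna 2012, §18.7; Urquhart
1987, Lemma 4.1; Biggs 1974, Prop. 4.3] -/
theorem card_critAt (hG : G.Connected) (hodd : Odd (Finset.univ.filter fun u => c u = true).card)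
    (u : Fin N) : (critAt G c u).card = 2 ^ (3 * N ^ 2 - N + 1) := by
  classical
  -- notation
  let E : Type := ↥G.edgeFinset
  let pat : (Fin (3 * N ^ 2) → Bool) → E → Bool := fun x e => edgeVal (pad x) e.1
  let zvec : (E → Bool) → E → ZMod 2 := fun y e => if y e = true then 1 else 0
  let row : Fin N → E → ZMod 2 := fun w e => if w ∈ e.1 then 1 else 0
  let c' : Fin N → ZMod 2 := fun w => (if c w = true then 1 else 0) + (if w = u then 1 else 0)
  let Ψ : AffSys E := Finset.univ.image fun w => (row w, c' w)
  -- ### the coboundary map and its rank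
  let δ : (Fin N → ZMod 2) →ₗ[ZMod 2] (E → ZMod 2) :=
    LinearMap.pi fun e : E => ∑ w ∈ Finset.univ.filter (fun w : Fin N => w ∈ e.1), LinearMap.proj w
  have hδ : ∀ (l : Fin N → ZMod 2) (e : E), δ l e = ∑ w, if w ∈ e.1 then l w else 0 := by
    intro l e
    have : δ l e = ∑ w ∈ Finset.univ.filter (fun w : Fin N => w ∈ e.1), l w := by
      simp only [δ, LinearMap.pi_apply, LinearMap.sum_apply]
      rfl
    rw [this, Finset.sum_filter]
  have hδ_edge : ∀ (l : Fin N → ZMod 2) (a b : Fin N) (hab : s(a, b) ∈ G.edgeFinset),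
      δ l ⟨s(a, b), hab⟩ = l a + l b := by
    intro l a b hab
    have hne : a ≠ b := G.ne_of_adj (SimpleGraph.mem_edgeFinset.mp hab)
    rw [hδ]
    have : (Finset.univ.filter fun w : Fin N => w ∈ s(a, b)) = {a, b} := by
      ext w
      simp [Sym2.mem_iff]
    rw [← Finset.sum_filter, this, Finset.sum_pair hne]
  have h2 : ∀ x y : ZMod 2, x + y = 0 ↔ x = y := by decide
  -- kernel = constants
  have hker : LinearMap.ker δ = Submodule.span (ZMod 2) {fun _ => (1 : ZMod 2)} := by
    apply le_antisymm
    · intro l hl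
      rw [LinearMap.mem_ker] at hl
      have hadj : ∀ a b, G.Adj a b → l a = l b := by
        intro a b hab
        have := congrFun hl ⟨s(a, b), SimpleGraph.mem_edgeFinset.mpr hab⟩
        rw [hδ_edge] at this
        exact (h2 _ _).mp this
      rw [Submodule.mem_span_singleton]
      refine ⟨l u, ?_⟩
      funext v
      obtain ⟨p⟩ := hG u v
      simp only [Pi.smul_apply, smul_eq_mul, mul_one]
      exact eq_of_forall_adj_eq G hadj p
    · rw [Submodule.span_le]
      intro l hl
      rw [Set.mem_singleton_iff] at hl
      subst hl
      rw [SetLike.mem_coe, LinearMap.mem_ker]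
      funext e
      obtain ⟨e', he'⟩ := e
      induction e' using Sym2.ind with
      | h a b =>
        rw [hδ_edge, Pi.zero_apply]
        exact (h2 _ _).mpr rfl
  have hker_rank : finrank (ZMod 2) (LinearMap.ker δ) = 1 := by
    rw [hker]
    apply finrank_span_singleton
    intro h
    have := congrFun h u
    exact one_ne_zero this
  have hrange_rank : finrank (ZMod 2) (LinearMap.range δ) + 1 = N := by
    have := LinearMap.finrank_range_add_finrank_ker δ
    rw [hker_rank, Module.finrank_fintype_fun_eq_card, Fintype.card_fin] at this
    exact this
  -- ### the incidence system `Ψ`: forms = rows = range of `δ`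
  have hrow : ∀ w, row w = δ (Pi.single w 1) := by
    intro w
    funext e
    rw [hδ, Finset.sum_eq_single w (fun b _ hb => by simp [hb]) (fun h => absurd (Finset.mem_univ w) h)]
    simp only [row, Pi.single_eq_same]
  have hspan : spanS Ψ = LinearMap.range δ := by
    have hforms : (forms Ψ : Set (E → ZMod 2)) = δ '' Set.range (fun w : Fin N => Pi.single w (1 : ZMod 2)) := by
      ext f
      simp only [forms, Ψ, Finset.coe_image, Finset.coe_univ, Set.image_univ, Set.mem_image,
        Set.mem_range, exists_exists_eq_and, hrow]
    rw [spanS, hforms, ← Submodule.map_span, LinearMap.range_eq_map]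
    congr 1
    have hr : (Set.range fun w : Fin N => Pi.single w (1 : ZMod 2)) =
        Set.range (Pi.basisFun (ZMod 2) (Fin N)) := by
      ext f
      simp [Pi.basisFun_apply]
    rw [hr]
    exact (Pi.basisFun (ZMod 2) (Fin N)).span_eq
  have hrank : finrank (ZMod 2) (spanS Ψ) + 1 = N := by rw [hspan]; exact hrange_rank
  -- ### membership: `x` is `u`-critical iff its lifted edge values solve `Ψ`
  have hrowdot : ∀ (y : E → Bool) (w : Fin N), row w ⬝ᵥ zvec y =
      ((((G.neighborFinset w).filter fun w' => ∃ h : s(w, w') ∈ G.edgeFinset,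
        y ⟨s(w, w'), h⟩ = true).card : ℕ) : ZMod 2) := by
    intro y w
    let F : Sym2 (Fin N) → ZMod 2 := fun e' =>
      if ∃ h : e' ∈ G.edgeFinset, y ⟨e', h⟩ = true then 1 else 0
    have hz : zvec y = fun e => F e.1 := by
      funext e
      by_cases hy : y e = true
      · simp only [zvec, F, if_pos hy, if_pos (⟨e.2, hy⟩ : ∃ h : e.1 ∈ G.edgeFinset, y ⟨e.1, h⟩ = true)]
      · simp only [zvec, F, if_neg hy]
        rw [if_neg]
        rintro ⟨_, h⟩
        exact hy h
    rw [hz]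
    show (fun e : E => if w ∈ e.1 then (1 : ZMod 2) else 0) ⬝ᵥ (fun e => F e.1) = _
    rw [indicatorRow_dotProduct G F w, Finset.natCast_card_filter]
  have hmem : ∀ x : Fin (3 * N ^ 2) → Bool, x ∈ critAt G c u ↔ zvec (pat x) ∈ Sol Ψ := by
    intro x
    rw [mem_critAt, mem_Sol]
    have hcount : ∀ w, ((((G.neighborFinset w).filter fun w' => edgeVal (pad x) s(w, w') = true).card
        : ℕ) : ZMod 2) = row w ⬝ᵥ zvec (pat x) := by
      intro w
      rw [hrowdot]
      congr 2
      ext w'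
      simp only [Finset.mem_filter, SimpleGraph.mem_neighborFinset, pat, and_congr_right_iff]
      intro hw'
      exact ⟨fun h => ⟨SimpleGraph.mem_edgeFinset.mpr hw', h⟩, fun ⟨_, h⟩ => h⟩
    have h01 : ∀ a : ZMod 2, a + 1 ≠ a := by decide
    constructor
    · intro h q hq
      have hq' : q ∈ Finset.univ.image (fun w => (row w, c' w)) := hq
      obtain ⟨w, -, rfl⟩ := Finset.mem_image.mp hq'
      have hw := h w
      unfold vertexOK at hw
      rw [decide_eq_true_eq, mod_two_eq_toNat_iff, hcount] at hw
      show row w ⬝ᵥ zvec (pat x) = c' w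
      by_cases hwu : w = u
      · subst hwu
        simp only [c', if_true]
        have hne : ¬ (row w ⬝ᵥ zvec (pat x) = if c w = true then 1 else 0) := fun h' => by
          simp [h'] at hw
        revert hne
        generalize row w ⬝ᵥ zvec (pat x) = a
        cases c w <;> revert a <;> decide
      · simp only [c', if_neg hwu, add_zero]
        exact hw.mpr hwu
    · intro h w
      have hq : (row w, c' w) ∈ Ψ := Finset.mem_image.mpr ⟨w, Finset.mem_univ w, rfl⟩
      have hw := h _ hq
      unfold vertexOK
      rw [decide_eq_true_eq, mod_two_eq_toNat_iff, hcount]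
      change row w ⬝ᵥ zvec (pat x) = c' w at hw
      rw [hw]
      by_cases hwu : w = u
      · subst hwu
        simp only [c', if_true]
        constructor
        · intro h'
          exact absurd h' (h01 _)
        · intro h'
          exact absurd rfl h'
      · simp only [c', if_neg hwu, add_zero]
        exact ⟨fun _ => hwu, fun _ => trivial⟩
  -- ### the system is consistent (Urquhart: even charges are realisable on connected graphs)
  have hsum : ∑ w, c' w = 0 := by
    simp only [c', Finset.sum_add_distrib]
    rw [Finset.sum_ite_eq', Finset.sum_boole, if_pos (Finset.mem_univ u),
      (ZMod.natCast_eq_one_iff_odd).mpr hodd]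
    decide
  have hcons : (Sol Ψ).Nonempty := by
    obtain ⟨yz, hyz⟩ := exists_edgeLabel_of_sum_eq_zero G hG _ c' le_rfl hsum
    refine ⟨fun e => yz e.1, ?_⟩
    rw [mem_Sol]
    intro q hq
    have hq' : q ∈ Finset.univ.image (fun w => (row w, c' w)) := hq
    obtain ⟨w, -, rfl⟩ := Finset.mem_image.mp hq'
    show (fun e : E => if w ∈ e.1 then (1 : ZMod 2) else 0) ⬝ᵥ (fun e : E => yz e.1) = c' w
    rw [indicatorRow_dotProduct G yz w, ← hyz w, SimpleGraph.neighborFinset_eq_filter]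
  -- ### counting
  -- the solutions `y`, as Booleans
  let Y : Finset (E → Bool) := Finset.univ.filter fun y => ∀ w : Fin N, row w ⬝ᵥ zvec y = c' w
  have hYmem : ∀ y, y ∈ Y ↔ zvec y ∈ Sol Ψ := by
    intro y
    simp only [Y, Finset.mem_filter, Finset.mem_univ, true_and, mem_Sol]
    constructor
    · intro h q hq
      have hq' : q ∈ Finset.univ.image (fun w => (row w, c' w)) := hq
      obtain ⟨w, -, rfl⟩ := Finset.mem_image.mp hq'
      exact h w
    · intro h w
      exact h _ (Finset.mem_image.mpr ⟨w, Finset.mem_univ w, rfl⟩)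
  have hY : Y.card = 2 ^ (G.edgeFinset.card - finrank (ZMod 2) (spanS Ψ)) := by
    have h3 : ∀ a : ZMod 2, (if decide (a = 1) = true then (1 : ZMod 2) else 0) = a := by decide
    -- `Y ≃ Sol Ψ`
    have hequiv : {y : E → Bool // ∀ w : Fin N, row w ⬝ᵥ zvec y = c' w} ≃ Sol Ψ :=
      { toFun := fun y => ⟨zvec y.1, (hYmem y.1).mp (Finset.mem_filter.mpr ⟨Finset.mem_univ _, y.2⟩)⟩
        invFun := fun z => ⟨fun e => decide (z.1 e = 1), by
          have hz : zvec (fun e => decide (z.1 e = 1)) = z.1 := funext fun e => h3 (z.1 e)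
          have := (hYmem (fun e => decide (z.1 e = 1))).mpr (by rw [hz]; exact z.2)
          exact (Finset.mem_filter.mp this).2⟩
        left_inv := fun y => by
          apply Subtype.ext
          funext e
          show decide (zvec y.1 e = 1) = y.1 e
          have hb : ∀ bb : Bool, decide ((if bb = true then (1 : ZMod 2) else 0) = 1) = bb := by
            decide
          exact hb (y.1 e)
        right_inv := fun z => by
          apply Subtype.ext
          funext e
          exact h3 (z.1 e) }
    have h1 := card_Sol_eq_two_pow Ψ hcons
    have hcardE : Fintype.card E = G.edgeFinset.card := Fintype.card_coe _
    rw [← Nat.card_congr hequiv, Nat.card_eq_fintype_card, hcardE] at h1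
    rw [← h1]
    exact (Fintype.card_subtype _).symm
  -- fibrewise count of the critical assignments
  have hfib : (critAt G c u).card = ∑ y ∈ Y, (Finset.univ.filter fun x : Fin (3 * N ^ 2) → Bool =>
      pat x = y).card := by
    rw [Finset.card_eq_sum_card_fiberwise (f := pat) (t := Y) (fun x hx =>
      (hYmem (pat x)).mpr ((hmem x).mp hx))]
    refine Finset.sum_congr rfl (fun y hy => ?_)
    congr 1
    ext x
    simp only [Finset.mem_filter, Finset.mem_univ, true_and, and_iff_right_iff_imp]
    intro hx
    rw [hmem, hx]
    exact (hYmem y).mp hy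
  rw [hfib, Finset.sum_congr rfl (fun y _ => card_filter_edgeVal_eq G y), Finset.sum_const,
    smul_eq_mul, hY, ← pow_add]
  -- exponent arithmetic: `(|E| - (N - 1)) + (3N² - |E|) = 3N² - N + 1`
  have hE : G.edgeFinset.card ≤ 3 * N ^ 2 := by
    have h1 := SimpleGraph.card_edgeFinset_le_card_choose_two (G := G)
    rw [Fintype.card_fin] at h1
    have h2 : N.choose 2 ≤ N ^ 2 := by
      rw [Nat.choose_two_right]
      calc N * (N - 1) / 2 ≤ N * (N - 1) := Nat.div_le_self _ _
        _ ≤ N * N := Nat.mul_le_mul_left N (Nat.sub_le N 1)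
        _ = N ^ 2 := (pow_two N).symm
    omega
  have hle : finrank (ZMod 2) (spanS Ψ) ≤ G.edgeFinset.card := by
    have := Submodule.finrank_le (spanS Ψ)
    rw [Module.finrank_fintype_fun_eq_card, Fintype.card_coe] at this
    exact this
  have hexp : G.edgeFinset.card - finrank (ZMod 2) (spanS Ψ) + (3 * N ^ 2 - G.edgeFinset.card) =
      3 * N ^ 2 - N + 1 := by
    have hN : N ≤ N ^ 2 := by nlinarith
    generalize finrank (ZMod 2) (spanS Ψ) = k at hrank hle ⊢
    generalize G.edgeFinset.card = m at hle hE ⊢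
    generalize N ^ 2 = Q at hN hE ⊢
    omega
  rw [hexp]

end ResLinBoundaryLaw

end Summit.PneNP.PneNP.Theorems
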